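import Summits.ValiantsHypothesis.ValiantsHypothesis.Theorems.KPlusLogSqLawStaticPathFoldDefs

/-!
# Route «KPlusLogSqLaw» — parametric max-weight independent set on a path: THEOREM T, part 2 — left tips of corridors are unique and exist

HONEST FRAMING.  Helper toward the crux `WeakLifting` (item `stmt-ValiantsHypothesis-19561`, route `KPlusLogSqLaw`, cell `pub-symmetroid`,
seat val-sym-lift-p4 g20, 2026-08-29) on the line of its witness-plan stub `stub_tridiagonalSectorB` (tropical twin of the STATIC tridiagonal
sector = parametric maximum-weight independent set on a path).  Second of three files putting the lineage's THEOREM T (val-sym-lift-p4 g14,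
`HOME/val-sym-lift-p4/THEOREM-T.md`: «pair creations + annihilations ≤ 2n») in the kernel; this one is the GEOMETRY, made discrete (no convexity
or compactness library): for lines `L t θ = a t θ + b t` with the camps of `gap` (even lines belong ABOVE a vertex, odd lines BELOW), a LEFT TIP
of the index window `[i, j]` is a pair `p < q` of the window with `p + q` odd, the odd line FLATTER than the even line, and every other line of
the window strictly on its correct side of the vertex `L p ∩ L q` (THEOREM-T.md Lemma 2: these vertices are the leftmost points of the window's
corridor).  (1) `leftTip_unique`: a window has at most one left tip — each of two tips lies weakly to the right of the other's crossing abscissa,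
strictly unless they share the line in question (sign algebra of two lines, §1).  (2) `leftTip_between`: in general position (distinct slopes,
no three concurrent), if a sub-window `[i, j₁]` and a super-window `[i, j₃]` have left tips then so does `[i, j₂]` for `j₁ ≤ j₂ ≤ j₃` — the
tip is the (ceiling, floor) candidate pair of `[i, j₂]` with the LARGEST crossing abscissa, the super-window's tip vertex serving as a point of
the closed corridor (THEOREM-T.md Lemmas 1 and 3).  (3) `tip_reflect`: under `θ ↦ -θ` (slopes negated) left tips become right tips (odd line
steeper) with the same correctness conditions.  Part 1 (`…StaticPathMixedEventsCount`) is the rectangle / alternating-sum count; part 3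
(`…StaticPathMixedEvents`) concludes «mixed events ≤ 2n».  Statements about a labelled line arrangement; nothing here asserts anything about
`WeakLifting`, `TropicalB`, `KPlusLogSqLaw`, the stub in its window, `MatrixDescartes` (stmt-ValiantsHypothesis-18050) or `VP ≠ VNP`.
-/

set_option linter.dupNamespace false
set_option autoImplicit false

namespace Summit.ValiantsHypothesis.ValiantsHypothesis.Theorems.KPlusLogSqLaw

open Finset Classical

namespace StaticPathFold

noncomputable section

variable (a b : ℕ → ℝ)

/-! ## 1. Sign algebra of two lines around their crossing abscissa `(b v - b u) / (a u - a v)` -/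

/-- the crossing abscissa is symmetric in the pair. [folklore] -/
theorem crossAbs_symm (u v : ℕ) : (b v - b u) / (a u - a v) = (b u - b v) / (a v - a u) := by
  rw [← neg_sub (b u), ← neg_sub (a v), neg_div_neg_eq]

/-- point–slope form of the difference of two lines around their crossing abscissa. [folklore] -/
theorem L_sub_L_eq {u v : ℕ} (h : a u ≠ a v) (θ : ℝ) :
    L a b v θ - L a b u θ = (a v - a u) * (θ - (b v - b u) / (a u - a v)) := by
  have h' : a u - a v ≠ 0 := sub_ne_zero.mpr h
  unfold L
  field_simp
  ring

/-- two lines agree at their crossing abscissa. [folklore] -/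
theorem L_eq_L_crossAbs {u v : ℕ} (h : a u ≠ a v) :
    L a b v ((b v - b u) / (a u - a v)) = L a b u ((b v - b u) / (a u - a v)) := by
  have := L_sub_L_eq a b h ((b v - b u) / (a u - a v))
  rw [sub_self, mul_zero] at this
  linarith

/-- the flatter line `u` is weakly below the steeper line `v` exactly to the right of their crossing (closed form). [folklore] -/
theorem L_le_L_iff_crossAbs_le {u v : ℕ} (h : a u < a v) (θ : ℝ) :
    L a b u θ ≤ L a b v θ ↔ (b v - b u) / (a u - a v) ≤ θ := by
  rw [← sub_nonneg, L_sub_L_eq a b (ne_of_lt h), mul_nonneg_iff_of_pos_left (sub_pos.mpr h), sub_nonneg]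

/-- the flatter line `u` is strictly below the steeper line `v` exactly strictly to the right of their crossing. [folklore] -/
theorem L_lt_L_iff_crossAbs_lt {u v : ℕ} (h : a u < a v) (θ : ℝ) :
    L a b u θ < L a b v θ ↔ (b v - b u) / (a u - a v) < θ := by
  rw [← sub_pos, L_sub_L_eq a b (ne_of_lt h), mul_pos_iff_of_pos_left (sub_pos.mpr h), sub_pos]

/-- the steeper line `v` is weakly below the flatter line `u` exactly to the left of their crossing. [folklore] -/
theorem L_le_L_iff_le_crossAbs {u v : ℕ} (h : a u < a v) (θ : ℝ) :
    L a b v θ ≤ L a b u θ ↔ θ ≤ (b v - b u) / (a u - a v) := by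
  rw [← not_lt, L_lt_L_iff_crossAbs_lt a b h, not_lt]

/-- the steeper line `v` is strictly below the flatter line `u` exactly strictly to the left of their crossing. [folklore] -/
theorem L_lt_L_iff_lt_crossAbs {u v : ℕ} (h : a u < a v) (θ : ℝ) :
    L a b v θ < L a b u θ ↔ θ < (b v - b u) / (a u - a v) := by
  rw [← not_le, L_le_L_iff_crossAbs_le a b h, not_le]

/-! ## 2. A window has at most one left tip -/

/-- core of the uniqueness of left tips, in ceiling/floor roles: two (ceiling `e`, floor `o`) pairs of the window `[i, j]`, each with the floor
flatter than the ceiling and every other line of the window strictly on its correct side of the pair's vertex, coincide — each vertex lies weakly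
to the right of the other's crossing abscissa, and strictly unless the pairs share the line in question. [folklore] -/
theorem leftTip_unique_core (i j e o e' o' : ℕ) (τ τ' y y' : ℝ) (he : Even e) (ho : ¬ Even o) (he' : Even e') (ho' : ¬ Even o')
    (hs : a o < a e) (hs' : a o' < a e')
    (hej : i ≤ e ∧ e ≤ j) (hoj : i ≤ o ∧ o ≤ j) (hej' : i ≤ e' ∧ e' ≤ j) (hoj' : i ≤ o' ∧ o' ≤ j)
    (hτ : τ = (b e - b o) / (a o - a e)) (hτ' : τ' = (b e' - b o') / (a o' - a e'))
    (hye : y = L a b e τ) (hyo : y = L a b o τ) (hye' : y' = L a b e' τ') (hyo' : y' = L a b o' τ')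
    (hG : ∀ t, i ≤ t → t ≤ j → t ≠ e → t ≠ o → 0 < gap t y (L a b t τ))
    (hG' : ∀ t, i ≤ t → t ≤ j → t ≠ e' → t ≠ o' → 0 < gap t y' (L a b t τ')) : e = e' ∧ o = o' := by
  have hne1 : o' ≠ e := fun h => ho' (h ▸ he)
  have hne2 : e' ≠ o := fun h => ho (h ▸ he')
  have hne3 : o ≠ e' := fun h => ho (h ▸ he')
  have hne4 : e ≠ o' := fun h => ho' (h ▸ he)
  -- the primed lines at the unprimed vertex
  have h1 : L a b o' τ ≤ y := by
    by_cases h : o' = o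
    · rw [h, hyo]
    · have := hG o' hoj'.1 hoj'.2 hne1 h
      unfold gap at this; rw [if_neg ho'] at this; linarith
  have h2 : y ≤ L a b e' τ := by
    by_cases h : e' = e
    · rw [h, hye]
    · have := hG e' hej'.1 hej'.2 h hne2
      unfold gap at this; rw [if_pos he'] at this; linarith
  have hτ'τ : τ' ≤ τ := by rw [hτ']; exact (L_le_L_iff_crossAbs_le a b hs' τ).mp (h1.trans h2)
  -- the unprimed lines at the primed vertex
  have h1' : L a b o τ' ≤ y' := by
    by_cases h : o = o'
    · rw [h, hyo']
    · have := hG' o hoj.1 hoj.2 hne3 h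
      unfold gap at this; rw [if_neg ho] at this; linarith
  have h2' : y' ≤ L a b e τ' := by
    by_cases h : e = e'
    · rw [h, hye']
    · have := hG' e hej.1 hej.2 h hne4
      unfold gap at this; rw [if_pos he] at this; linarith
  have hττ' : τ ≤ τ' := by rw [hτ]; exact (L_le_L_iff_crossAbs_le a b hs τ').mp (h1'.trans h2')
  have heq : τ = τ' := le_antisymm hττ' hτ'τ
  -- strictness forces the pairs to share both lines
  have ho_eq : o = o' := by
    by_contra h
    have hlt : L a b o' τ < y := by
      have := hG o' hoj'.1 hoj'.2 hne1 (Ne.symm h)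
      unfold gap at this; rw [if_neg ho'] at this; linarith
    have := (L_lt_L_iff_crossAbs_lt a b hs' τ).mp (hlt.trans_le h2)
    rw [← hτ', heq] at this
    exact lt_irrefl _ this
  have he_eq : e = e' := by
    by_contra h
    have hlt : y < L a b e' τ := by
      have := hG e' hej'.1 hej'.2 (Ne.symm h) hne2
      unfold gap at this; rw [if_pos he'] at this; linarith
    have := (L_lt_L_iff_crossAbs_lt a b hs' τ).mp (h1.trans_lt hlt)
    rw [← hτ', heq] at this
    exact lt_irrefl _ this
  exact ⟨he_eq, ho_eq⟩

/-- **A WINDOW HAS AT MOST ONE LEFT TIP**: two left-type mixed pairs `p < q`, `p' < q'` of the window `[i, j]` (odd index sum, the odd line flatter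
than the even line), each with every other line of the window strictly on its correct side of its vertex, are equal (THEOREM-T Lemma 1,
uniqueness half; no convexity library — sign algebra only). [folklore] -/
theorem leftTip_unique (i j p q p' q' : ℕ)
    (hp : i ≤ p) (hpq : p < q) (hq : q ≤ j) (hodd : Odd (p + q)) (hlt : if Even p then a q < a p else a p < a q)
    (hG : ∀ t, i ≤ t → t ≤ j → t ≠ p → t ≠ q →
      0 < gap t (L a b p ((b q - b p) / (a p - a q))) (L a b t ((b q - b p) / (a p - a q))))
    (hp' : i ≤ p') (hpq' : p' < q') (hq' : q' ≤ j) (hodd' : Odd (p' + q')) (hlt' : if Even p' then a q' < a p' else a p' < a q')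
    (hG' : ∀ t, i ≤ t → t ≤ j → t ≠ p' → t ≠ q' →
      0 < gap t (L a b p' ((b q' - b p') / (a p' - a q'))) (L a b t ((b q' - b p') / (a p' - a q')))) :
    p = p' ∧ q = q' := by
  set τ := (b q - b p) / (a p - a q) with hτ
  set τ' := (b q' - b p') / (a p' - a q') with hτ'
  rcases Nat.even_or_odd p with hpe | hpo <;> rcases Nat.even_or_odd p' with hpe' | hpo'
  · -- both smaller indices even: roles (e, o) = (p, q), (e', o') = (p', q')
    rw [if_pos hpe] at hlt; rw [if_pos hpe'] at hlt'
    have hqo : ¬ Even q := fun h => by rw [Nat.odd_add'] at hodd; exact (Nat.not_even_iff_odd.mpr (hodd.mpr hpe)) h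
    have hqo' : ¬ Even q' := fun h => by rw [Nat.odd_add'] at hodd'; exact (Nat.not_even_iff_odd.mpr (hodd'.mpr hpe')) h
    have h := leftTip_unique_core a b i j p q p' q' τ τ' (L a b p τ) (L a b p' τ') hpe hqo hpe' hqo' hlt hlt'
      ⟨hp, by omega⟩ ⟨by omega, hq⟩ ⟨hp', by omega⟩ ⟨by omega, hq'⟩
      (by rw [hτ, crossAbs_symm]) (by rw [hτ', crossAbs_symm]) rfl (by rw [hτ]; exact (L_eq_L_crossAbs a b (ne_of_gt hlt)).symm)
      rfl (by rw [hτ']; exact (L_eq_L_crossAbs a b (ne_of_gt hlt')).symm)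
      (fun t h1 h2 h3 h4 => hG t h1 h2 h3 h4) (fun t h1 h2 h3 h4 => hG' t h1 h2 h3 h4)
    exact h
  · rw [if_pos hpe] at hlt; rw [if_neg (Nat.not_even_iff_odd.mpr hpo')] at hlt'
    have hqo : ¬ Even q := fun h => by rw [Nat.odd_add'] at hodd; exact (Nat.not_even_iff_odd.mpr (hodd.mpr hpe)) h
    have hqe' : Even q' := by rw [Nat.odd_add] at hodd'; exact hodd'.mp hpo'
    have h := leftTip_unique_core a b i j p q q' p' τ τ' (L a b p τ) (L a b p' τ') hpe hqo hqe' (Nat.not_even_iff_odd.mpr hpo') hlt hlt'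
      ⟨hp, by omega⟩ ⟨by omega, hq⟩ ⟨by omega, hq'⟩ ⟨hp', by omega⟩
      (by rw [hτ, crossAbs_symm]) (by rw [hτ']) rfl (by rw [hτ]; exact (L_eq_L_crossAbs a b (ne_of_gt hlt)).symm)
      (by rw [hτ']; exact (L_eq_L_crossAbs a b (ne_of_lt hlt')).symm) rfl
      (fun t h1 h2 h3 h4 => hG t h1 h2 h3 h4) (fun t h1 h2 h3 h4 => hG' t h1 h2 h4 h3)
    omega
  · rw [if_neg (Nat.not_even_iff_odd.mpr hpo)] at hlt; rw [if_pos hpe'] at hlt'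
    have hqe : Even q := by rw [Nat.odd_add] at hodd; exact hodd.mp hpo
    have hqo' : ¬ Even q' := fun h => by rw [Nat.odd_add'] at hodd'; exact (Nat.not_even_iff_odd.mpr (hodd'.mpr hpe')) h
    have h := leftTip_unique_core a b i j q p p' q' τ τ' (L a b p τ) (L a b p' τ') hqe (Nat.not_even_iff_odd.mpr hpo) hpe' hqo' hlt hlt'
      ⟨by omega, hq⟩ ⟨hp, by omega⟩ ⟨hp', by omega⟩ ⟨by omega, hq'⟩
      (by rw [hτ]) (by rw [hτ', crossAbs_symm]) (by rw [hτ]; exact (L_eq_L_crossAbs a b (ne_of_lt hlt)).symm) rfl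
      rfl (by rw [hτ']; exact (L_eq_L_crossAbs a b (ne_of_gt hlt')).symm)
      (fun t h1 h2 h3 h4 => hG t h1 h2 h4 h3) (fun t h1 h2 h3 h4 => hG' t h1 h2 h3 h4)
    omega
  · rw [if_neg (Nat.not_even_iff_odd.mpr hpo)] at hlt; rw [if_neg (Nat.not_even_iff_odd.mpr hpo')] at hlt'
    have hqe : Even q := by rw [Nat.odd_add] at hodd; exact hodd.mp hpo
    have hqe' : Even q' := by rw [Nat.odd_add] at hodd'; exact hodd'.mp hpo'
    have h := leftTip_unique_core a b i j q p q' p' τ τ' (L a b p τ) (L a b p' τ') hqe (Nat.not_even_iff_odd.mpr hpo) hqe'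
      (Nat.not_even_iff_odd.mpr hpo') hlt hlt'
      ⟨by omega, hq⟩ ⟨hp, by omega⟩ ⟨by omega, hq'⟩ ⟨hp', by omega⟩
      (by rw [hτ]) (by rw [hτ']) (by rw [hτ]; exact (L_eq_L_crossAbs a b (ne_of_lt hlt)).symm) rfl
      (by rw [hτ']; exact (L_eq_L_crossAbs a b (ne_of_lt hlt')).symm) rfl
      (fun t h1 h2 h3 h4 => hG t h1 h2 h4 h3) (fun t h1 h2 h3 h4 => hG' t h1 h2 h4 h3)
    exact ⟨h.2, h.1⟩

/-! ## 3. Existence of left tips: the candidate pair with the largest crossing abscissa -/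

/-- **EXISTENCE OF THE LEFT TIP** (THEOREM-T Lemmas 1–3, made discrete): in general position, if the window `[i, j₂]` contains an odd line
flatter than some even line (witnessed by a left tip of a sub-window `[i, j₁]`) and its closed corridor is nonempty (witnessed by the vertex
of a left tip of a super-window `[i, j₃]`), then `[i, j₂]` has a left tip — namely the (ceiling, floor) candidate pair whose crossing
abscissa is LARGEST.  Hence, for fixed `i`, the right ends `j` of the windows `[i, j]` having a left tip form an interval. [folklore] -/
theorem leftTip_between (n : ℕ) (hslope : ∀ p q, p ≤ n → q ≤ n → p ≠ q → a p ≠ a q)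
    (hgp : ∀ p q t, p ≤ n → q ≤ n → t ≤ n → p ≠ q → t ≠ p → t ≠ q →
      L a b t ((b q - b p) / (a p - a q)) ≠ L a b p ((b q - b p) / (a p - a q)))
    (i j₁ j₂ j₃ : ℕ) (h12 : j₁ ≤ j₂) (h23 : j₂ ≤ j₃) (h3n : j₃ ≤ n)
    (h1 : ∃ p q, i ≤ p ∧ p < q ∧ q ≤ j₁ ∧ (Odd (p + q) ∧ (if Even p then a q < a p else a p < a q)) ∧
      ∀ t, i ≤ t → t ≤ j₁ → t ≠ p → t ≠ q → 0 < gap t (L a b p ((b q - b p) / (a p - a q))) (L a b t ((b q - b p) / (a p - a q))))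
    (h3 : ∃ p q, i ≤ p ∧ p < q ∧ q ≤ j₃ ∧ (Odd (p + q) ∧ (if Even p then a q < a p else a p < a q)) ∧
      ∀ t, i ≤ t → t ≤ j₃ → t ≠ p → t ≠ q → 0 < gap t (L a b p ((b q - b p) / (a p - a q))) (L a b t ((b q - b p) / (a p - a q)))) :
    ∃ p q, i ≤ p ∧ p < q ∧ q ≤ j₂ ∧ (Odd (p + q) ∧ (if Even p then a q < a p else a p < a q)) ∧
      ∀ t, i ≤ t → t ≤ j₂ → t ≠ p → t ≠ q → 0 < gap t (L a b p ((b q - b p) / (a p - a q))) (L a b t ((b q - b p) / (a p - a q))) := by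
  -- (a) a candidate (ceiling, floor) pair with the floor flatter, inside `[i, j₂]`
  obtain ⟨p₁, q₁, hp₁, hpq₁, hq₁, ⟨hodd₁, hlt₁⟩, -⟩ := h1
  set Cand := ((Icc i j₂) ×ˢ (Icc i j₂)).filter (fun uv : ℕ × ℕ => Even uv.1 ∧ ¬ Even uv.2 ∧ a uv.2 < a uv.1) with hCand
  have hne : Cand.Nonempty := by
    rcases Nat.even_or_odd p₁ with hpe | hpo
    · refine ⟨(p₁, q₁), ?_⟩
      rw [if_pos hpe] at hlt₁
      have hqo : ¬ Even q₁ := fun h => by rw [Nat.odd_add'] at hodd₁; exact (Nat.not_even_iff_odd.mpr (hodd₁.mpr hpe)) h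
      rw [hCand, mem_filter, mem_product, mem_Icc, mem_Icc]
      exact ⟨⟨⟨hp₁, by omega⟩, ⟨by omega, by omega⟩⟩, hpe, hqo, hlt₁⟩
    · refine ⟨(q₁, p₁), ?_⟩
      rw [if_neg (Nat.not_even_iff_odd.mpr hpo)] at hlt₁
      have hqe : Even q₁ := by rw [Nat.odd_add] at hodd₁; exact hodd₁.mp hpo
      rw [hCand, mem_filter, mem_product, mem_Icc, mem_Icc]
      exact ⟨⟨⟨by omega, by omega⟩, ⟨hp₁, by omega⟩⟩, hqe, Nat.not_even_iff_odd.mpr hpo, hlt₁⟩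
  -- (b) a point of the closed corridor of `[i, j₂]`: the vertex of the tip of `[i, j₃]`
  obtain ⟨p₃, q₃, hp₃, hpq₃, hq₃, ⟨hodd₃, hlt₃⟩, hG₃⟩ := h3
  set τ₃ := (b q₃ - b p₃) / (a p₃ - a q₃) with hτ₃
  set y₃ := L a b p₃ τ₃ with hy₃
  have hA₃ : a p₃ ≠ a q₃ := by split_ifs at hlt₃ <;> [exact ne_of_gt hlt₃; exact ne_of_lt hlt₃]
  have hwit : ∀ t, i ≤ t → t ≤ j₂ → (Even t → y₃ ≤ L a b t τ₃) ∧ (¬ Even t → L a b t τ₃ ≤ y₃) := by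
    intro t ht1 ht2
    by_cases htp : t = p₃
    · subst htp; exact ⟨fun _ => le_rfl, fun _ => le_rfl⟩
    by_cases htq : t = q₃
    · subst htq
      have : L a b t τ₃ = y₃ := by rw [hy₃, hτ₃]; exact L_eq_L_crossAbs a b hA₃
      rw [this]; exact ⟨fun _ => le_rfl, fun _ => le_rfl⟩
    have hg := hG₃ t ht1 (by omega) htp htq
    unfold gap at hg
    constructor
    · intro hte; rw [if_pos hte] at hg; linarith
    · intro hto; rw [if_neg hto] at hg; linarith
  -- (c) the candidate with the largest crossing abscissa
  obtain ⟨⟨e, o⟩, hmem, hmax⟩ := exists_max_image Cand (fun uv : ℕ × ℕ => (b uv.1 - b uv.2) / (a uv.2 - a uv.1)) hne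
  rw [hCand, mem_filter, mem_product, mem_Icc, mem_Icc] at hmem
  obtain ⟨⟨⟨hie, hej⟩, ⟨hio, hoj⟩⟩, he, ho, hs⟩ := hmem
  simp only at he ho hs hie hej hio hoj
  set τ := (b e - b o) / (a o - a e) with hτ
  set y := L a b e τ with hy
  have hyo : y = L a b o τ := by rw [hy, hτ]; exact L_eq_L_crossAbs a b (ne_of_lt hs)
  have hen : e ≤ n := by omega
  have hon : o ≤ n := by omega
  have heo : e ≠ o := fun h => ho (h ▸ he)
  -- `τ ≤ τ₃`: the floor `o` is weakly below the ceiling `e` at the corridor point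
  have hττ₃ : τ ≤ τ₃ := by
    have h1 := (hwit o hio hoj).2 ho
    have h2 := (hwit e hie hej).1 he
    rw [hτ]; exact (L_le_L_iff_crossAbs_le a b hs τ₃).mp (h1.trans h2)
  -- (d) every other line of the window is strictly on its correct side of the vertex `(τ, y)`
  have hgood : ∀ t, i ≤ t → t ≤ j₂ → t ≠ e → t ≠ o → 0 < gap t y (L a b t τ) := by
    intro t ht1 ht2 hte hto
    have htn : t ≤ n := by omega
    have hne_val : L a b t τ ≠ y := by rw [hyo, hτ]; exact hgp o e t hon hen htn (Ne.symm heo) hto hte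
    unfold gap
    rcases Nat.even_or_odd t with hpe | hpo
    · -- a ceiling: it must pass strictly above the vertex
      rw [if_pos hpe, sub_pos]
      by_contra hle
      have hlt : L a b t τ < L a b o τ := lt_of_le_of_ne (by rw [← hyo]; exact not_lt.mp hle) (by rw [← hyo]; exact hne_val)
      rcases lt_or_gt_of_ne (hslope o t hon htn (Ne.symm hto)) with hot | hto'
      · -- `(t, o)` is a candidate with a larger crossing abscissa
        have hmemt : (t, o) ∈ Cand := by
          rw [hCand, mem_filter, mem_product, mem_Icc, mem_Icc]
          exact ⟨⟨⟨ht1, ht2⟩, ⟨hio, hoj⟩⟩, hpe, ho, hot⟩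
        have h1 := hmax (t, o) hmemt
        have h2 := (L_lt_L_iff_lt_crossAbs a b hot τ).mp hlt
        simp only at h1
        exact absurd (lt_of_lt_of_le h2 h1) (lt_irrefl _)
      · -- `t` flatter than `o`: the corridor point contradicts
        have h1 : τ₃ ≤ (b o - b t) / (a t - a o) :=
          (L_le_L_iff_le_crossAbs a b hto' τ₃).mp (((hwit o hio hoj).2 ho).trans ((hwit t ht1 ht2).1 hpe))
        have h2 : (b o - b t) / (a t - a o) < τ := (L_lt_L_iff_crossAbs_lt a b hto' τ).mp hlt
        linarith
    · -- a floor: it must pass strictly below the vertex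
      have hto2 : ¬ Even t := Nat.not_even_iff_odd.mpr hpo
      rw [if_neg hto2, sub_pos]
      by_contra hle
      have hlt : L a b e τ < L a b t τ := lt_of_le_of_ne (by rw [← hy]; exact not_lt.mp hle) (by rw [← hy]; exact Ne.symm hne_val)
      rcases lt_or_gt_of_ne (hslope t e htn hen hte) with hte' | het
      · -- `(e, t)` is a candidate with a larger crossing abscissa
        have hmemt : (e, t) ∈ Cand := by
          rw [hCand, mem_filter, mem_product, mem_Icc, mem_Icc]
          exact ⟨⟨⟨hie, hej⟩, ⟨ht1, ht2⟩⟩, he, hto2, hte'⟩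
        have h1 := hmax (e, t) hmemt
        have h2 := (L_lt_L_iff_lt_crossAbs a b hte' τ).mp hlt
        simp only at h1
        exact absurd (lt_of_lt_of_le h2 h1) (lt_irrefl _)
      · have h1 : τ₃ ≤ (b t - b e) / (a e - a t) :=
          (L_le_L_iff_le_crossAbs a b het τ₃).mp (((hwit t ht1 ht2).2 hto2).trans ((hwit e hie hej).1 he))
        have h2 : (b t - b e) / (a e - a t) < τ := (L_lt_L_iff_crossAbs_lt a b het τ).mp hlt
        linarith
  -- (e) the tip, as an ordered pair
  rcases lt_or_gt_of_ne heo with hlt | hgt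
  · refine ⟨e, o, hie, hlt, hoj, ⟨?_, by rw [if_pos he]; exact hs⟩, fun t h1 h2 h3 h4 => ?_⟩
    · rw [Nat.odd_add']; exact ⟨fun _ => he, fun _ => Nat.not_even_iff_odd.mp ho⟩
    · have hc : (b o - b e) / (a e - a o) = τ := by rw [hτ, crossAbs_symm]
      rw [hc, ← hy]; exact hgood t h1 h2 h3 h4
  · refine ⟨o, e, hio, hgt, hej, ⟨?_, by rw [if_neg ho]; exact hs⟩, fun t h1 h2 h3 h4 => ?_⟩
    · rw [Nat.odd_add]; exact ⟨fun _ => he, fun _ => Nat.not_even_iff_odd.mp ho⟩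
    · rw [← hτ, ← hyo]; exact hgood t h1 h2 h4 h3

/-! ## 4. The reflection `θ ↦ -θ`: right tips of `a` are left tips of `-a` -/

/-- under the reflection `θ ↦ -θ` (slopes negated) the vertices keep their values, so correctness at a vertex is unchanged. [folklore] -/
theorem gap_reflect (a' : ℕ → ℝ) (ha' : ∀ s, a' s = -a s) (p q t : ℕ) :
    gap t (L a' b p ((b q - b p) / (a' p - a' q))) (L a' b t ((b q - b p) / (a' p - a' q))) =
      gap t (L a b p ((b q - b p) / (a p - a q))) (L a b t ((b q - b p) / (a p - a q))) := by
  have hc : (b q - b p) / (a' p - a' q) = -((b q - b p) / (a p - a q)) := by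
    rw [ha', ha', show -a p - -a q = -(a p - a q) by ring, div_neg]
  have hL : ∀ s, L a' b s ((b q - b p) / (a' p - a' q)) = L a b s ((b q - b p) / (a p - a q)) := by
    intro s; unfold L; rw [hc, ha']; ring
  rw [hL, hL]

/-- the tip predicate of a window under the reflection: left tips of the reflected arrangement are the RIGHT tips (odd line steeper) of the
original one, with the same correctness conditions. [folklore] -/
theorem tip_reflect (a' : ℕ → ℝ) (ha' : ∀ s, a' s = -a s) (i j p q : ℕ) :
    (i ≤ p ∧ p < q ∧ q ≤ j ∧ (Odd (p + q) ∧ (if Even p then a' q < a' p else a' p < a' q)) ∧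
      ∀ t, i ≤ t → t ≤ j → t ≠ p → t ≠ q → 0 < gap t (L a' b p ((b q - b p) / (a' p - a' q))) (L a' b t ((b q - b p) / (a' p - a' q)))) ↔
    (i ≤ p ∧ p < q ∧ q ≤ j ∧ (Odd (p + q) ∧ (if Even p then a p < a q else a q < a p)) ∧
      ∀ t, i ≤ t → t ≤ j → t ≠ p → t ≠ q → 0 < gap t (L a b p ((b q - b p) / (a p - a q))) (L a b t ((b q - b p) / (a p - a q)))) := by
  have h1 : (if Even p then a' q < a' p else a' p < a' q) ↔ (if Even p then a p < a q else a q < a p) := by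
    rw [ha', ha']; split_ifs <;> exact neg_lt_neg_iff
  simp_rw [gap_reflect a b a' ha']
  rw [h1]

end

end StaticPathFold

end Summit.ValiantsHypothesis.ValiantsHypothesis.Theorems.KPlusLogSqLaw
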